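import Summits.SmoothPoincare4.SmoothPoincare4.Theses.EntropyRung
import Literature.Geometry.Riemannian.RoundCylinderFourVolume
import Literature.Geometry.Riemannian.PuncturedShrinkingSphereFour

/-!
# The decay clause of `ConicalGap` (negative / hygiene lemmas for crux stmt-SmoothPoincare4-16589)

`EntropyRung.ConicalGap` (route EntropyRung, rank 8) is the parent crux `NoncompactShrinkerGap` plus ONE
clause, the decay of the scalar curvature at infinity, typed
`∀ ε > 0, ∃ K : Set M, IsCompact K ∧ ∀ x ∉ K, g.scalarCurvature x < ε`.
This file pins down exactly what that clause does and does not do, kernel-checked: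

* `conicalGap_decayClause_iff_eventually_cocompact` — it is `∀ ε > 0, ∀ᶠ x in cocompact M, R x < ε` (pure topology);
  `conicalGap_decayClause_iff_tendsto_of_nonneg` — for `R ≥ 0` (which complete shrinkers satisfy: Zhang 2009 / Chen
  2009, tree fact `shrinkerScalarCurvature_nonneg`) it is `Tendsto R (cocompact M) (𝓝 0)`, the intended
  "`R → 0` at infinity" = asymptotically conical class (Munteanu–Wang).
* `conicalGap_decayClause_of_nonpos` — the clause is ONE-SIDED: any `R ≤ 0` satisfies it with `K = ∅`. For complete
  shrinkers this is immaterial (`R ≥ 0`), but WITHOUT completeness it is not: the explicit incomplete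
  U(2)-invariant Kähler shrinkers `ψ_μ(φ) = φ/μ + 4(1−μ)/μ² + 8(1−μ)/(μ³φ)`, `f = (μ/2)·φ + 2(1−μ)`… (Calabi
  ansatz, `0 < μ < 1`, on `{|z| > r₀} ⊂ ℂ²`; Cruxes/ConicalGap/Disproof.lean §(e)) have `R = 2(μ−1)/(μφ) < 0`,
  satisfy every other hypothesis of the crux, and have `∫ e^{-f} dV = 16π² e^{2(μ−1)}/μ² > 16π²`: completeness
  is load-bearing for `ConicalGap`, and through this one-sided door.
* `conicalGap_decayClause_of_compactSpace` — on a compact `M` the clause is vacuous (`K = univ`); cf. the landed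
  `conicalGap_false_without_noncompact` (`S⁴(√6)` passes the clause this way).
* `conicalGap_not_decayClause_of_pos_const_le` and its two instances `conicalGap_roundCylinderFour_not_decayClause` (`R ≡ 3/2`),
  `conicalGap_puncturedShrinkingSphereFour_not_decayClause` (`R ≡ 2`): the clause EXCLUDES the parent crux's extremiser
  `S³(2)×ℝ` (`Theorems/NoncompactShrinkerGap/Negative/TightAtCylinder.lean`: `∫ e^{-f} dV` = the bound exactly)
  and the parent's completeness / normalisation witnesses. Consequences for provers: (i) the constant
  `32π²√π e^{-3/2}` is NOT known to be sharp on the conical class — the largest density of a KNOWN member is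
  FIK's `e^{√2−2}(1+√2)/(2√2)·2 = .672 < .791` (margin 15 %), and the strict form `<` of `ConicalGap` is not
  refuted by anything in the tree or in print; (ii) dropping the clause gives back `NoncompactShrinkerGap`
  (`conicalGap_of_noncompactShrinkerGap`, Theorems/EntropyRungNoncompactShrinkerGapReduction.lean), so the clause
  is load-bearing for TRUTH only if the parent crux is false — it is a proof-enabling restriction (conical
  structure at infinity, Kotschwar–Wang rigidity), not a certified necessity.

Refuter negative lemmas (cdisprove), `--supports stmt-SmoothPoincare4-16589`; no statement here asserts a
Theses decl.
-/

noncomputable section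

set_option linter.dupNamespace false

namespace Summit.SmoothPoincare4.SmoothPoincare4.Theorems.ConicalGap.Negative

open scoped Manifold ContDiff Topology NNReal
open Filter Set
open Literature.Geometry.Riemannian Literature.Geometry.Lorentzian
open Literature.Geometry.Lorentzian.PseudoRiemannianMetric

/-- The decay clause of `ConicalGap` is the filter statement "`R < ε` eventually along `cocompact M`, for
every `ε > 0`" (pure topology, any `R : M → ℝ`). [folklore] -/
theorem conicalGap_decayClause_iff_eventually_cocompact (M : Type) [TopologicalSpace M] (R : M → ℝ) :
    (∀ ε : ℝ, 0 < ε → ∃ K : Set M, IsCompact K ∧ ∀ x, x ∉ K → R x < ε) ↔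
      ∀ ε : ℝ, 0 < ε → ∀ᶠ x in cocompact M, R x < ε := by
  refine forall₂_congr fun ε _ ↦ ?_
  simp only [Filter.Eventually, Filter.mem_cocompact, Set.subset_def, Set.mem_compl_iff,
    Set.mem_setOf_eq]

/-- For a NONNEGATIVE function (e.g. the scalar curvature of a complete gradient shrinker, Zhang 2009
Thm 1.3 (ii)) the decay clause of `ConicalGap` is exactly `R → 0` at infinity:
`Tendsto R (cocompact M) (𝓝 0)`. [folklore] -/
theorem conicalGap_decayClause_iff_tendsto_of_nonneg (M : Type) [TopologicalSpace M] (R : M → ℝ)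
    (hR : ∀ x, 0 ≤ R x) :
    (∀ ε : ℝ, 0 < ε → ∃ K : Set M, IsCompact K ∧ ∀ x, x ∉ K → R x < ε) ↔
      Tendsto R (cocompact M) (𝓝 0) := by
  rw [conicalGap_decayClause_iff_eventually_cocompact, Metric.tendsto_nhds]
  refine forall₂_congr fun ε _ ↦ Filter.eventually_congr (Filter.Eventually.of_forall fun x ↦ ?_)
  rw [Real.dist_eq, sub_zero, abs_of_nonneg (hR x)]

/-- ONE-SIDEDNESS: any function with `R ≤ 0` everywhere satisfies the decay clause, with `K = ∅`. (So the
clause does not force `R → 0` without the sign information `R ≥ 0` that only COMPLETENESS provides; the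
explicit incomplete Kähler shrinkers with `R < 0` of Cruxes/ConicalGap/Disproof.lean §(e) enter the
hypotheses of `ConicalGap` minus completeness through this door.) [folklore] -/
theorem conicalGap_decayClause_of_nonpos (M : Type) [TopologicalSpace M] (R : M → ℝ) (hR : ∀ x, R x ≤ 0) :
    ∀ ε : ℝ, 0 < ε → ∃ K : Set M, IsCompact K ∧ ∀ x, x ∉ K → R x < ε :=
  fun _ hε ↦ ⟨∅, isCompact_empty, fun x _ ↦ (hR x).trans_lt hε⟩

/-- VACUITY ON COMPACT SPACES: on a compact `M` every function satisfies the decay clause (`K = univ`);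
the clause has force only together with `[NoncompactSpace M]` (cf. `conicalGap_false_without_noncompact`:
`S⁴(√6)` passes it this way). [folklore] -/
theorem conicalGap_decayClause_of_compactSpace (M : Type) [TopologicalSpace M] [CompactSpace M] (R : M → ℝ) :
    ∀ ε : ℝ, 0 < ε → ∃ K : Set M, IsCompact K ∧ ∀ x, x ∉ K → R x < ε :=
  fun _ _ ↦ ⟨univ, isCompact_univ, fun x hx ↦ absurd (mem_univ x) hx⟩

/-- On a NON-COMPACT space a function bounded below by a positive constant violates the decay clause.
[folklore] -/
theorem conicalGap_not_decayClause_of_pos_const_le (M : Type) [TopologicalSpace M] [NoncompactSpace M]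
    (R : M → ℝ) (c : ℝ) (hc : 0 < c) (hR : ∀ x, c ≤ R x) :
    ¬ (∀ ε : ℝ, 0 < ε → ∃ K : Set M, IsCompact K ∧ ∀ x, x ∉ K → R x < ε) := by
  intro h
  obtain ⟨K, hK, hRK⟩ := h c hc
  have hKu : K = univ := by
    refine eq_univ_of_forall fun x ↦ ?_
    by_contra hx
    exact absurd (hRK x hx) (not_lt.mpr (hR x))
  exact noncompact_univ M (hKu ▸ hK)

/-- **The parent crux's extremiser is outside the conical class**: the round cylinder `S³(2) × ℝ`
(`Literature/Geometry/Riemannian/RoundCylinderFour*.lean`, realised on `ℝ⁴ ∖ 0`; it satisfies every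
hypothesis of `NoncompactShrinkerGap` and attains its bound, `noncompactShrinkerGap_tight_at_cylinder`) has
constant scalar curvature `3/2`, so it violates the decay clause of `ConicalGap`. Hence tightness of the
constant `32π²√πe^{-3/2}` is NOT witnessed on the conical class (largest known density there: FIK, `.672`),
and the strict variant of `ConicalGap` is not refuted by the tree's models. [folklore] -/
theorem conicalGap_roundCylinderFour_not_decayClause :
    ¬ (∀ ε : ℝ, 0 < ε → ∃ K : Set RoundCylinderFour.P4, IsCompact K ∧
        ∀ x, x ∉ K → RoundCylinderFour.cylP.scalarCurvature x < ε) :=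
  conicalGap_not_decayClause_of_pos_const_le RoundCylinderFour.P4 _ (3 / 2) (by norm_num)
    fun x ↦ (RoundCylinderFour.scalarCurvature_cylP x).ge

/-- **The parent crux's completeness witness is outside the conical class**: the punctured shrinking sphere
`S⁴(√6) ∖ pt` (`PuncturedShrinkingSphereFour.lean`, the conformally flat metric `96(|y|²+4)⁻²δ` on `ℝ⁴`,
`f ≡ 2`; it refutes `NoncompactShrinkerGap` minus completeness) has constant scalar curvature `2`, so it
violates the decay clause: for `ConicalGap` the necessity of completeness needs a different (conical,
sign-changing or negative `R`) witness — see Cruxes/ConicalGap/Disproof.lean §(e). [folklore] -/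
theorem conicalGap_puncturedShrinkingSphereFour_not_decayClause :
    ¬ (∀ ε : ℝ, 0 < ε → ∃ K : Set PuncturedSphereFour.W4, IsCompact K ∧
        ∀ x, x ∉ K → PuncturedSphereFour.punctP.scalarCurvature x < ε) :=
  conicalGap_not_decayClause_of_pos_const_le PuncturedSphereFour.W4 _ 2 (by norm_num)
    fun x ↦ (PuncturedSphereFour.scalarCurvature_punctP x).ge

end Summit.SmoothPoincare4.SmoothPoincare4.Theorems.ConicalGap.Negative

end
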